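import Summits.HodgeConjecture.HodgeConjecture.Theorems.Ring2AbelianAllWeilCellsAnchored
import HarnessLib

/-!
# Ring 2 · AbelianAll (ab-weil-1, gen 8, part 5) — the residual leaves on the WRONG-SIGN cells are vacuous:
  `IsogenyConnected`, `VHC(δ)` and every pointed family leaf hold outright when `sign δ ≠ (-1)ⁿ`

research route, not a corollary; conditional on HC_CM plus one named minimal statement.
Cell line: research route conditional on HC_CM; not a corollary; Q11.4-sentence-2 already refuted in dim ≥ 3.
`HC_CM` (`Theses.RankFourFaces.CMAbelianHodge`) does not occur in this file. NOTHING here is a case of the Hodge conjecture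
with content: every statement below holds because its premises name a polarized Weil-type member (or a charted fibre
carrying a non-zero Weil class) of a component whose sign is wrong, and gen 7's signature theorem
(`not_hasWeilDiscriminantNondeg_of_weilSign_ne`, van Geemen Lemma 5.2 (4) on the carriers) says there is none.

Purpose: book-keeping for the atlas. Part 4 split every cell as
`WeilClassesComponent n d δ ⟸ IsogenyConnectedWeilComponent n d δ ∧ WeilVariationalHodgeComponent n d δ` and part 2 showed
the cells are inhabited iff `sign δ = (-1)ⁿ`. This file records that the two leaves (and gen 5's pointed leaves
`PointedWeilFamiliesComponent n d δ anchor` for ANY anchor — CM-pointed, anchored, divisor-generated) are TRUE on every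
wrong-sign index (`n, d ≥ 1`): along a `(ℚ(√-d), 2n, δ)`-Weil family of wrong sign every fibrewise `(n,n)` restriction of
the global class VANISHES in the chart (`map_restrict_eq_zero_of_hasWeilChartsOfDisc_of_weilSign_ne`), so it is
algebraic; and the pointed / connectedness leaves quantify over members carrying a non-zero Weil class, of which there are
none. Hence the typed residual pair `(IC, VHC)` is contentful EXACTLY on the inhabited cells, and the column row of part 4
may be fed the pair on all indices (`weilClassesByComponent_of_forall_isogenyConnected_and_variational`).

## References
* B. van Geemen, *An introduction to the Hodge conjecture for abelian varieties*, LNM 1594 (1994), 4.14, Lemma 5.2 (4),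
  5.3–5.5. [vanGeemen1994HodgeAV]
* F. Charles, C. Schnell, *Notes on absolute Hodge classes* (2014), Conj. 11.3.1. [CharlesSchnell2014Notes]
-/

noncomputable section

set_option linter.dupNamespace false

open CategoryTheory AlgebraicGeometry
open Literature.AlgebraicGeometry Literature.AlgebraicGeometry.Motives
open Literature.AlgebraicGeometry.HodgeTheory
open Literature.AlgebraicGeometry.VanGeemen1994
open Literature.AlgebraicTopology.SingularHomology
open Summit.HodgeConjecture.HodgeConjecture.Ring2.Hypotheses

namespace Summit.HodgeConjecture.HodgeConjecture.Ring2.AbelianAll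

/-! ### §1 Along a wrong-sign δ-Weil family the `(n,n)` restrictions vanish in every chart -/

/-- **No non-zero `(n,n)` Weil class survives a wrong-sign chart.** If the fibres of `f` are charted by pairs
`(A', φ')` (`dim A' = 2n`, `φ'² = -d`) polarized with discriminant class `δ` of the WRONG sign, and `W|_{𝒳_s}` is of
type `(n,n)` and lands in the Weil classes of the chart, then its transport to the chart is ZERO: otherwise the chart
would be of Weil type (Deligne–Milne 4.4 ⇒, `isWeilType_of_weilClass_ne_zero`) and gen 7's signature theorem would
forbid the class `δ`. [cite: vanGeemen1994HodgeAV, 4.14 and Lemma 5.2 (4)] -/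
theorem map_restrict_eq_zero_of_hasWeilChartsOfDisc_of_weilSign_ne {n d : ℕ} (hn : 0 < n) (hd : 0 < d)
    {δ : weilNormResidueGroup d} (h : weilSign d δ ≠ (-1) ^ n) {𝒳 S : SchemeOver ℂ} {f : 𝒳 ⟶ S}
    {W : complexBetti 𝒳 (2 * n)}
    (hH : ∀ s : ComplexPoints S,
      IsOfHodgeType (2 * n) (fiberOver f s) (2 * n) n n (complexBetti.map (fiberι f s) (2 * n) W))
    (hch : HasWeilChartsOfDisc n d δ f W) (s : ComplexPoints S) :
    ∃ (A' : AbelianVariety ℂ) (e' : A'.X ≅ fiberOver f s),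
      complexBetti.map e'.hom (2 * n) (complexBetti.map (fiberι f s) (2 * n) W) = 0 := by
  obtain ⟨A', φ', e', hA', hφ', hW', e'', a'', ha'', ha''0, hN⟩ := hch s
  refine ⟨A', e', ?_⟩
  by_contra hx0
  exact not_hasWeilDiscriminantNondeg_of_weilSign_ne
    (isWeilType_of_weilClass_ne_zero hn hd hA' hφ' hW' hx0 ((isOfHodgeType_map_iff_of_iso e').2 (hH s)))
    e'' ha'' ha''0 h hN

/-- Hence every restriction is ALGEBRAIC (it is zero in a chart, and algebraicity transports along the chart).
[cite: vanGeemen1994HodgeAV, 4.14 and Lemma 5.2 (4)] -/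
theorem restrict_mem_algebraicClasses_of_hasWeilChartsOfDisc_of_weilSign_ne {n d : ℕ} (hn : 0 < n) (hd : 0 < d)
    {δ : weilNormResidueGroup d} (h : weilSign d δ ≠ (-1) ^ n) {𝒳 S : SchemeOver ℂ} {f : 𝒳 ⟶ S}
    {W : complexBetti 𝒳 (2 * n)}
    (hH : ∀ s : ComplexPoints S,
      IsOfHodgeType (2 * n) (fiberOver f s) (2 * n) n n (complexBetti.map (fiberι f s) (2 * n) W))
    (hch : HasWeilChartsOfDisc n d δ f W) (s : ComplexPoints S) :
    complexBetti.map (fiberι f s) (2 * n) W ∈ algebraicClasses (fiberOver f s) n := by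
  obtain ⟨A', e', h0⟩ := map_restrict_eq_zero_of_hasWeilChartsOfDisc_of_weilSign_ne hn hd h hH hch s
  exact (mem_algebraicClasses_map_iff_of_iso e').1 (by rw [h0]; exact Submodule.zero_mem _)

/-! ### §2 The leaves on a wrong-sign index hold outright -/

/-- **`VHC(δ)` on a wrong-sign index holds** (vacuously in content: every fibrewise restriction is algebraic because
it vanishes in a chart; the marked algebraic fibre is not even used). [cite: CharlesSchnell2014Notes, Conj. 11.3.1]
[cite: vanGeemen1994HodgeAV, Lemma 5.2 (4)] -/
theorem weilVariationalHodgeComponent_of_weilSign_ne {n d : ℕ} (hn : 0 < n) (hd : 0 < d)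
    {δ : weilNormResidueGroup d} (h : weilSign d δ ≠ (-1) ^ n) : WeilVariationalHodgeComponent n d δ := by
  intro 𝒳 S f _ _ _ _ _ W hW hch _ s
  exact restrict_mem_algebraicClasses_of_hasWeilChartsOfDisc_of_weilSign_ne hn hd h (fun t => (hW t).2) hch s

/-- **Every pointed family leaf on a wrong-sign index holds, for ANY anchor**: its premises name a member of the
component carrying a non-zero rational `(n,n)` Weil class, and there is none (gen 7).
[cite: vanGeemen1994HodgeAV, 4.14 and Lemma 5.2 (4)] -/
theorem pointedWeilFamiliesComponent_of_weilSign_ne {n d : ℕ} (hn : 0 < n) (hd : 0 < d)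
    {δ : weilNormResidueGroup d} (h : weilSign d δ ≠ (-1) ^ n)
    (anchor : (X : SchemeOver ℂ) → complexBetti X (2 * n) → Prop) : PointedWeilFamiliesComponent n d δ anchor := by
  intro A φ hAdim _ hφ e a haQ ha0 hN c _ hcH hc hc0
  exact absurd hN (not_hasWeilDiscriminantNondeg_of_weilSign_ne
    (isWeilType_of_weilClass_ne_zero hn hd hAdim hφ hc hc0 hcH) e haQ ha0 h)

/-- In particular gen 5's three pointed leaves hold on every wrong-sign index. [cite: vanGeemen1994HodgeAV, Lemma 5.2 (4)] -/
theorem pointedLeaves_of_weilSign_ne {n d : ℕ} (hn : 0 < n) (hd : 0 < d) {δ : weilNormResidueGroup d}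
    (h : weilSign d δ ≠ (-1) ^ n) :
    CMPointedWeilFamiliesComponent n d δ ∧ AnchoredWeilFamiliesComponent n d δ ∧
      DivisorGeneratedCMPointedWeilFamiliesComponent n d δ :=
  ⟨pointedWeilFamiliesComponent_of_weilSign_ne hn hd h _, pointedWeilFamiliesComponent_of_weilSign_ne hn hd h _,
    pointedWeilFamiliesComponent_of_weilSign_ne hn hd h _⟩

/-- **`IsogenyConnectedWeilComponent` on a wrong-sign index holds** (same vacuity: no first member with a non-zero
Weil class). So the node of part 4 is contentful exactly on the inhabited components of part 2.
[cite: vanGeemen1994HodgeAV, 4.14 and Lemma 5.2 (4)] -/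
theorem isogenyConnectedWeilComponent_of_weilSign_ne {n d : ℕ} (hn : 0 < n) (hd : 0 < d)
    {δ : weilNormResidueGroup d} (h : weilSign d δ ≠ (-1) ^ n) : IsogenyConnectedWeilComponent n d δ := by
  intro A φ hAdim _ hφ e a haQ ha0 hN c _ hcH hc hc0
  exact absurd hN (not_hasWeilDiscriminantNondeg_of_weilSign_ne
    (isWeilType_of_weilClass_ne_zero hn hd hAdim hφ hc hc0 hcH) e haQ ha0 h)

/-- **The residual pair on a wrong-sign index.** [cite: vanGeemen1994HodgeAV, Lemma 5.2 (4)] -/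
theorem residualPair_of_weilSign_ne {n d : ℕ} (hn : 0 < n) (hd : 0 < d) {δ : weilNormResidueGroup d}
    (h : weilSign d δ ≠ (-1) ^ n) :
    IsogenyConnectedWeilComponent n d δ ∧ WeilVariationalHodgeComponent n d δ :=
  ⟨isogenyConnectedWeilComponent_of_weilSign_ne hn hd h, weilVariationalHodgeComponent_of_weilSign_ne hn hd h⟩

/-! ### §3 The table read uniformly -/

/-- **On every index the residual pair is EQUIVALENT to "the pair on the right sign"**: the atlas may list
`IC(n,d,δ) ∧ VHC(n,d,δ)` against every `δ`, the wrong-sign entries being theorems. [cite: vanGeemen1994HodgeAV, Lemma 5.2 (4)] -/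
theorem residualPair_iff_of_sign {n d : ℕ} (hn : 0 < n) (hd : 0 < d) (δ : weilNormResidueGroup d) :
    (IsogenyConnectedWeilComponent n d δ ∧ WeilVariationalHodgeComponent n d δ) ↔
      (weilSign d δ = (-1) ^ n → IsogenyConnectedWeilComponent n d δ ∧ WeilVariationalHodgeComponent n d δ) :=
  ⟨fun hp _ => hp, fun hp => (em (weilSign d δ = (-1) ^ n)).elim hp (residualPair_of_weilSign_ne hn hd)⟩

/-- **The column from the residual pair on ALL indices** (part 4's signed row, fed uniformly).
[cite: vanGeemen1994HodgeAV, 4.14, 5.3–5.5] [cite: CharlesSchnell2014Notes, Conj. 11.3.1] -/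
theorem weilClassesByComponent_of_forall_isogenyConnected_and_variational
    (h : ∀ n : ℕ, 2 ≤ n → ∀ d : ℕ, 0 < d → ∀ δ : weilNormResidueGroup d,
      IsogenyConnectedWeilComponent n d δ ∧ WeilVariationalHodgeComponent n d δ) :
    WeilClassesByComponent :=
  weilClassesByComponent_of_isogenyConnected_of_variational fun n hn d hd δ _ => h n hn d hd δ

/-- **Conversely the signed supply suffices for the uniform one** — the two column hypotheses are interchangeable.
[cite: vanGeemen1994HodgeAV, Lemma 5.2 (4)] -/
theorem forall_residualPair_iff_sign :
    (∀ n : ℕ, 2 ≤ n → ∀ d : ℕ, 0 < d → ∀ δ : weilNormResidueGroup d,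
        IsogenyConnectedWeilComponent n d δ ∧ WeilVariationalHodgeComponent n d δ) ↔
      (∀ n : ℕ, 2 ≤ n → ∀ d : ℕ, 0 < d → ∀ δ : weilNormResidueGroup d, weilSign d δ = (-1) ^ n →
        IsogenyConnectedWeilComponent n d δ ∧ WeilVariationalHodgeComponent n d δ) :=
  ⟨fun hp n hn d hd δ _ => hp n hn d hd δ,
    fun hp n hn d hd δ => (residualPair_iff_of_sign (by omega) hd δ).2 (hp n hn d hd δ)⟩

/-- **The fourfold residual cells, uniformly**: the dim `≤ 5` floor of part 4 may be fed `IC(2,d₀,δ) ∧ VHC(2,d₀,δ)` on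
the non-split squarefree cells of EITHER sign (the negative ones are theorems). [cite: MoonenZarhin1999, Thm. 0.1]
[cite: vanGeemen1994HodgeAV, 5.3–5.5] [cite: CharlesSchnell2014Notes, Conj. 11.3.1] -/
theorem hodgeConjectureFor_abelian_dim_le_five_of_refereed_connected_variational'
    (hred : MoonenZarhin1999_hodgeClasses_abelian_dim_le_five_of_weilClassesFourfolds)
    (hK : Koike2004_weilClasses_algebraic_hyperbolicSixfold_one)
    (hS : Schoen1998_weilClasses_algebraic_hyperbolicSixfold_three)
    (hL : LandherrSplitCriterion) (hM23 : Markman2023_weilClasses_algebraic_discOneWeilFourfold)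
    (hCV : ∀ d : ℕ, 0 < d → Squarefree d → d ≠ 1 → d ≠ 3 → ∀ δ : weilNormResidueGroup d,
      δ ≠ splitDiscriminantClass 2 d →
        IsogenyConnectedWeilComponent 2 d δ ∧ WeilVariationalHodgeComponent 2 d δ)
    (A : AbelianVariety ℂ) (hA : A.dim ≤ 5) : HodgeConjectureFor A.dim A.X :=
  hodgeConjectureFor_abelian_dim_le_five_of_refereed_connected_variational hred hK hS hL hM23
    (fun d hd hsq h1 h3 δ hns _ => hCV d hd hsq h1 h3 δ hns) A hA

end Summit.HodgeConjecture.HodgeConjecture.Ring2.AbelianAll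

end
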